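import Mathlib
import HarnessLib
import Summits.NavierStokesRegularity.NavierStokesRegularity.Theorems.UnthreadedDoorCellFluxCriticalCapBound

/-!
# Route `UnthreadedDoor`, crux `PoloidalLiouville` (stmt-NavierStokesRegularity-1222), WALL W1 — crux idea «cell-flux», support toward
# Σ-0bR₂ `ClusterFluxNearCentreLipschitz`: the event step at APPROXIMATELY critical points (swept regions)

`…CellFluxCriticalCapBound` (p734149) controls the slice near an EXACT sphere-critical point `p` (`curl v (p) = 0`).  Between two parameters a class
boundary sweeps a sliver whose points were critical at an INTERMEDIATE parameter, hence are only approximately critical now: if `ζ ∈ S²` was a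
critical direction at radius `r''` then at radius `r'` one has `‖curl v (x₀ + r' ζ)‖ ≤ L |r' − r''|` (`norm_curl_le_of_sphCrit_radius`), and in time
`‖curl v(t') (y)‖ ≤ M ‖y − x₀‖ |t' − t|` if `y` was critical at time `t` (`NetFlux.exists_bound_curl_sub_curl`).  This file runs the great-circle
argument of p734149 from an `ε`-critical anchor:

* ★ `abs_sub_le_of_norm_curl_le` — `‖curl v (p)‖ ≤ ε`, `p, q ∈ S_r(x₀)`, `0 < r ≤ 1` ⇒ `|T q − T p| ≤ (π ε /(2 r)) ‖q − p‖ + (π² L /(4 r)) ‖q − p‖²`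
  (`ε = 0` is p734149's `abs_sub_le_of_mem_sphCrit`);
* `norm_curl_le_of_sphCrit_radius` — swept directions are `L|r' − r''|`-critical;
* `sSup_le_sSup_add_of_near_approxCrit` / `sInf_sub_le_sInf_of_near_approxCrit` / ★ `abs_setOsc_sub_setOsc_le_of_near_approxCrit` — the event step
  with `ε`-critical anchors: two nonempty `U, U' ⊆ S_r(x₀)` that differ only within `ρ` of `ε`-critical points of each other's closure satisfy
  `|osc_{U'} T − osc_U T| ≤ π ε ρ / r + π² L ρ² / (2 r)`.
With `ε = L|Δr|` (resp. `M a |Δt|`) and `ρ` the sliver width this is the custodian's «sliver lemma» (N1, bus 2026-08-29T16:57:15Z) in kernel form,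
free of any bound on the SPEED of the class boundary beyond `ρ → 0`.

HONEST LABEL: support lemmas strictly below W1; Σ-0bR₂, the cell-flux chain, `PoloidalLiouville` ⟨1222⟩, W1 and NS regularity are OPEN — NOT
proved.  `--supports stmt-NavierStokesRegularity-1222 --as helper`.  [folklore]
-/

noncomputable section

-- the summit and its single sub-problem share the name (CONVENTIONS §1)
set_option linter.dupNamespace false

open Set Function Filter Topology InnerProductSpace MeasureTheory
open scoped RealInnerProductSpace ContDiff

namespace Summit.NavierStokesRegularity.NavierStokesRegularity.Theorems.PoloidalLiouville.CellFlux

open Summit.NavierStokesRegularity.NavierStokesRegularity.Theorems.PoloidalLiouville.NetFlux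
  (E3 ne_center_of_mem_sphere continuousOn_sphere_of_continuousOn_compl bddAbove_image_sphere exists_greatCircle
   cross_add_smul_right cross_cross_eq_neg_of_unit_orth norm_cross_of_unit_orth inner_cross_right_eq_neg_inner_cross)
open Literature.Analysis Literature.Analysis.FluidPDE

/-! ### The quadratic-plus-linear bound at an approximately critical point -/

/-- ★ **Control near an `ε`-critical point.**  For `v ∈ C²`, `T ∈ C¹` off `x₀`, `curl v = ∇T × (x − x₀)`, `‖D curl v‖ ≤ L` on `B̄(x₀,1)`,
`0 < r ≤ 1`, `p, q ∈ S_r(x₀)` with `‖curl v (p)‖ ≤ ε`: `|T q − T p| ≤ (π ε /(2 r)) ‖q − p‖ + (π² L /(4 r)) ‖q − p‖²`.  Along the great circle `γ`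
from `p` to `q` (angle `θ₀ ∈ [0,π]`): `|(T∘γ)′(θ)| = |⟪n, curl v (γ θ)⟫| ≤ ε + L r θ₀`, so `|T q − T p| ≤ ε θ₀ + L r θ₀²`, and `θ₀ ≤ π‖q − p‖/(2r)`
(Jordan). [folklore] -/
theorem abs_sub_le_of_norm_curl_le {v : E3 → E3} {T : E3 → ℝ} {x₀ p q : E3} {L r ε : ℝ} (hv : ContDiff ℝ 2 v)
    (hT : ContDiffOn ℝ 1 T ({x₀}ᶜ)) (hrep : ∀ x, curl v x = cross (gradient T x) (x - x₀))
    (hL : ∀ x ∈ Metric.closedBall x₀ 1, ‖fderiv ℝ (curl v) x‖ ≤ L) (hr : 0 < r) (hr1 : r ≤ 1)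
    (hp : p ∈ Metric.sphere x₀ r) (hε : ‖curl v p‖ ≤ ε) (hq : q ∈ Metric.sphere x₀ r) :
    |T q - T p| ≤ Real.pi * ε / (2 * r) * ‖q - p‖ + Real.pi ^ 2 * L / (4 * r) * ‖q - p‖ ^ 2 := by
  have hpn : ‖p - x₀‖ = r := mem_sphere_iff_norm.1 hp
  have hqn : ‖q - x₀‖ = r := mem_sphere_iff_norm.1 hq
  have hω : ContDiff ℝ 1 (curl v) := contDiff_curl (n := 1) (by exact_mod_cast hv)
  have hL0 : 0 ≤ L := (norm_nonneg _).trans (hL x₀ (Metric.mem_closedBall_self zero_le_one))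
  have hε0 : 0 ≤ ε := (norm_nonneg _).trans hε
  obtain ⟨n, θ₀, hn1, hna, hθ₀, hb⟩ := exists_greatCircle (a := p - x₀) (b := q - x₀) hr hpn hqn
  -- the great circle (as in NF-0's arc bound)
  set γ : ℝ → E3 := fun θ => x₀ + (Real.cos θ • (p - x₀) + Real.sin θ • cross n (p - x₀)) with hγ_def
  have hγ0 : γ 0 = p := by simp [hγ_def]
  have hγ1 : γ θ₀ = q := by rw [hγ_def]; simp only; rw [← hb]; abel
  have hac : ⟪p - x₀, cross n (p - x₀)⟫ = 0 := by
    simp only [Tao2016.real_inner_fin3, cross_apply_zero, cross_apply_one, cross_apply_two]; ring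
  have hnw : ⟪n, cross n (p - x₀)⟫ = 0 := by
    have h := inner_cross_right_eq_neg_inner_cross n n (p - x₀)
    linarith
  have hnγ : ∀ θ, ⟪n, γ θ - x₀⟫ = 0 := by
    intro θ
    rw [hγ_def]
    simp only [add_sub_cancel_left, inner_add_right, real_inner_smul_right, hna, hnw, mul_zero, add_zero]
  have hγr : ∀ θ, ‖γ θ - x₀‖ = r := by
    intro θ
    have hsq : ‖γ θ - x₀‖ ^ 2 = r ^ 2 := by
      rw [hγ_def]
      simp only [add_sub_cancel_left]
      rw [← real_inner_self_eq_norm_sq, inner_add_left, inner_add_right, inner_add_right, real_inner_smul_left,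
        real_inner_smul_left, real_inner_smul_left, real_inner_smul_left, real_inner_smul_right,
        real_inner_smul_right, real_inner_smul_right, real_inner_smul_right, real_inner_self_eq_norm_sq,
        real_inner_self_eq_norm_sq, norm_cross_of_unit_orth hn1 hna, hpn, hac,
        real_inner_comm (p - x₀) (cross n (p - x₀)), hac]
      linear_combination r ^ 2 * Real.cos_sq_add_sin_sq θ
    have h := Real.sqrt_sq (norm_nonneg (γ θ - x₀))
    rw [hsq, Real.sqrt_sq hr.le] at h
    exact h.symm
  have hγne : ∀ θ, γ θ ≠ x₀ := fun θ h => by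
    have := hγr θ
    rw [h, sub_self, norm_zero] at this
    exact hr.ne' this.symm
  have hγball : ∀ θ, γ θ ∈ Metric.closedBall x₀ 1 := fun θ => by
    rw [Metric.mem_closedBall, dist_eq_norm, hγr θ]; exact hr1
  have hγd : ∀ θ, HasDerivAt γ (cross n (γ θ - x₀)) θ := by
    intro θ
    have h := (((Real.hasDerivAt_cos θ).smul_const (p - x₀)).add
      ((Real.hasDerivAt_sin θ).smul_const (cross n (p - x₀)))).const_add x₀
    have e : cross n (γ θ - x₀) = -Real.sin θ • (p - x₀) + Real.cos θ • cross n (p - x₀) := by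
      rw [hγ_def]
      simp only [add_sub_cancel_left]
      rw [cross_add_smul_right, cross_cross_eq_neg_of_unit_orth hn1 hna, smul_neg, ← neg_smul]
      abel
    rw [e]
    exact h
  have hγ'n : ∀ θ, ‖cross n (γ θ - x₀)‖ = r := fun θ => by rw [norm_cross_of_unit_orth hn1 (hnγ θ), hγr θ]
  have hchord : ∀ θ, ‖γ θ - p‖ ≤ r * |θ| := by
    intro θ
    have h := Convex.norm_image_sub_le_of_norm_hasDerivWithin_le (s := univ) (f := γ) (C := r)
      (fun s _ => (hγd s).hasDerivWithinAt) (fun s _ => (hγ'n s).le) convex_univ (mem_univ 0) (mem_univ θ)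
    rw [hγ0, sub_zero, Real.norm_eq_abs] at h
    exact h
  -- derivative of `T ∘ γ` and its bound `≤ ε + L r |θ|`
  set h' : ℝ → ℝ := fun θ => fderiv ℝ T (γ θ) (cross n (γ θ - x₀)) with hh'
  have hTd : ∀ θ, HasDerivAt (fun θ => T (γ θ)) (h' θ) θ := by
    intro θ
    have hd : DifferentiableAt ℝ T (γ θ) :=
      (hT.differentiableOn one_ne_zero _ (hγne θ)).differentiableAt (isOpen_compl_singleton.mem_nhds (hγne θ))
    exact hd.hasFDerivAt.comp_hasDerivAt θ (hγd θ)
  have hh'eq : ∀ θ, h' θ = -⟪n, curl v (γ θ)⟫ := by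
    intro θ
    simp only [hh']
    rw [← LocalHelmholtz.inner_gradient_left_eq_fderiv, inner_cross_right_eq_neg_inner_cross, hrep]
  have hbound : ∀ θ, |h' θ| ≤ ε + L * r * |θ| := by
    intro θ
    rw [hh'eq, abs_neg]
    have h1 : |⟪n, curl v (γ θ)⟫| ≤ ‖curl v (γ θ)‖ := by
      calc |⟪n, curl v (γ θ)⟫| ≤ ‖n‖ * ‖curl v (γ θ)‖ := abs_real_inner_le_norm _ _
        _ = ‖curl v (γ θ)‖ := by rw [hn1, one_mul]
    have h2 : ‖curl v (γ θ) - curl v p‖ ≤ L * ‖γ θ - p‖ :=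
      (convex_closedBall x₀ 1).norm_image_sub_le_of_norm_fderiv_le
        (fun y _ => (hω.differentiable one_ne_zero) y) hL
        (by rw [Metric.mem_closedBall, dist_eq_norm, hpn]; exact hr1) (hγball θ)
    have h3 : ‖curl v (γ θ)‖ ≤ ‖curl v p‖ + ‖curl v (γ θ) - curl v p‖ := by
      have := norm_add_le (curl v p) (curl v (γ θ) - curl v p)
      rwa [add_sub_cancel] at this
    calc |⟪n, curl v (γ θ)⟫| ≤ ‖curl v (γ θ)‖ := h1
      _ ≤ ε + L * ‖γ θ - p‖ := by linarith
      _ ≤ ε + L * (r * |θ|) := by gcongr; exact hchord θ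
      _ = ε + L * r * |θ| := by ring
  -- mean value inequality on `[0, θ₀]`
  have hmv := Convex.norm_image_sub_le_of_norm_hasDerivWithin_le (s := Icc 0 θ₀) (f := fun θ => T (γ θ))
    (C := ε + L * r * θ₀) (fun θ _ => (hTd θ).hasDerivWithinAt)
    (fun θ hθ => by
      rw [Real.norm_eq_abs]
      have h1 := hbound θ
      rw [abs_of_nonneg hθ.1] at h1
      have h2 : L * r * θ ≤ L * r * θ₀ := mul_le_mul_of_nonneg_left hθ.2 (by positivity)
      linarith)
    (convex_Icc 0 θ₀) (left_mem_Icc.2 hθ₀.1) (right_mem_Icc.2 hθ₀.1)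
  rw [hγ0, hγ1, sub_zero, Real.norm_eq_abs, Real.norm_eq_abs, abs_of_nonneg hθ₀.1] at hmv
  -- chord versus angle
  have hchord2 : ‖q - p‖ ^ 2 = 2 * r ^ 2 * (1 - Real.cos θ₀) := by
    have e : q - p = (Real.cos θ₀ - 1) • (p - x₀) + Real.sin θ₀ • cross n (p - x₀) := by
      have e1 : q - p = (q - x₀) - (p - x₀) := by abel
      rw [e1, hb, sub_smul, one_smul]
      abel
    rw [e, ← real_inner_self_eq_norm_sq, inner_add_left, inner_add_right, inner_add_right, real_inner_smul_left,
      real_inner_smul_left, real_inner_smul_left, real_inner_smul_left, real_inner_smul_right,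
      real_inner_smul_right, real_inner_smul_right, real_inner_smul_right, real_inner_self_eq_norm_sq,
      real_inner_self_eq_norm_sq, norm_cross_of_unit_orth hn1 hna, hpn, hac,
      real_inner_comm (p - x₀) (cross n (p - x₀)), hac]
    linear_combination r ^ 2 * Real.cos_sq_add_sin_sq θ₀
  have hjordan := two_mul_sq_div_pi_sq_le_one_sub_cos hθ₀.1 hθ₀.2
  have hpi : 0 < Real.pi := Real.pi_pos
  have hθsq : θ₀ ^ 2 ≤ (Real.pi / (2 * r) * ‖q - p‖) ^ 2 := by
    rw [mul_pow, div_pow, hchord2]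
    have h1 : θ₀ ^ 2 ≤ Real.pi ^ 2 / 2 * (1 - Real.cos θ₀) := by
      have h2 : 2 * θ₀ ^ 2 / Real.pi ^ 2 * (Real.pi ^ 2 / 2) = θ₀ ^ 2 := by field_simp
      have := mul_le_mul_of_nonneg_right hjordan (by positivity : (0 : ℝ) ≤ Real.pi ^ 2 / 2)
      rw [h2] at this
      linarith
    have h3 : Real.pi ^ 2 / (2 * r) ^ 2 * (2 * r ^ 2 * (1 - Real.cos θ₀)) = Real.pi ^ 2 / 2 * (1 - Real.cos θ₀) := by
      field_simp
    rw [h3]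
    exact h1
  have hθle : θ₀ ≤ Real.pi / (2 * r) * ‖q - p‖ := by
    have h0 : 0 ≤ Real.pi / (2 * r) * ‖q - p‖ := by positivity
    nlinarith [hθsq, hθ₀.1, h0]
  calc |T q - T p| ≤ (ε + L * r * θ₀) * θ₀ := hmv
    _ = ε * θ₀ + L * r * θ₀ ^ 2 := by ring
    _ ≤ ε * (Real.pi / (2 * r) * ‖q - p‖) + L * r * (Real.pi / (2 * r) * ‖q - p‖) ^ 2 :=
        add_le_add (mul_le_mul_of_nonneg_left hθle hε0) (mul_le_mul_of_nonneg_left hθsq (by positivity))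
    _ = Real.pi * ε / (2 * r) * ‖q - p‖ + Real.pi ^ 2 * L / (4 * r) * ‖q - p‖ ^ 2 := by
        field_simp
        ring

/-! ### Swept directions are approximately critical -/

/-- **A direction that was critical at radius `r''` is `L|r' − r''|`-critical at radius `r'`** (`r', r'' ∈ (0,1]`): if
`x₀ + r'' ζ ∈ sphCrit T x₀ r''` (`ζ ∈ S²`) then `‖curl v (x₀ + r' ζ)‖ ≤ L |r' − r''|`. [folklore] -/
theorem norm_curl_le_of_sphCrit_radius {v : E3 → E3} {T : E3 → ℝ} {x₀ ζ : E3} {L r' r'' : ℝ} (hv : ContDiff ℝ 2 v)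
    (hrep : ∀ x, curl v x = cross (gradient T x) (x - x₀))
    (hL : ∀ x ∈ Metric.closedBall x₀ 1, ‖fderiv ℝ (curl v) x‖ ≤ L)
    (hr' : 0 < r') (hr'1 : r' ≤ 1) (hr'' : 0 < r'') (hr''1 : r'' ≤ 1) (hζ : ζ ∈ Metric.sphere (0 : E3) 1)
    (hcrit : x₀ + r'' • ζ ∈ sphCrit T x₀ r'') :
    ‖curl v (x₀ + r' • ζ)‖ ≤ L * |r' - r''| := by
  have hω : ContDiff ℝ 1 (curl v) := contDiff_curl (n := 1) (by exact_mod_cast hv)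
  have hζ1 : ‖ζ‖ = 1 := by simpa using hζ
  have h0 : curl v (x₀ + r'' • ζ) = 0 := by rw [hrep]; exact hcrit.2
  have hmem : ∀ {σ : ℝ}, 0 < σ → σ ≤ 1 → x₀ + σ • ζ ∈ Metric.closedBall x₀ 1 := by
    intro σ hσ hσ1
    rw [Metric.mem_closedBall, dist_eq_norm, add_sub_cancel_left, norm_smul, Real.norm_of_nonneg hσ.le, hζ1, mul_one]
    exact hσ1
  have hmvt := (convex_closedBall x₀ 1).norm_image_sub_le_of_norm_fderiv_le
    (fun y _ => (hω.differentiable one_ne_zero) y) hL (hmem hr'' hr''1) (hmem hr' hr'1)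
  rw [h0, sub_zero, add_sub_add_left_eq_sub, ← sub_smul, norm_smul, hζ1, mul_one, Real.norm_eq_abs] at hmvt
  exact hmvt

/-! ### The event step with approximately critical anchors -/

/-- **Event step (upper half), `ε`-critical anchors**: if every point of `U'` lies in `U` or within `ρ` of a point `p ∈ closure U` with
`‖curl v (p)‖ ≤ ε`, then `sSup (T '' U') ≤ sSup (T '' U) + π ε ρ /(2 r) + π² L ρ² /(4 r)` (`U, U' ⊆ S_r(x₀)`, `U'` nonempty, `0 ≤ ρ`). [folklore] -/
theorem sSup_le_sSup_add_of_near_approxCrit {v : E3 → E3} {T : E3 → ℝ} {x₀ : E3} {L r ρ ε : ℝ} (hv : ContDiff ℝ 2 v)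
    (hT : ContDiffOn ℝ 1 T ({x₀}ᶜ)) (hrep : ∀ x, curl v x = cross (gradient T x) (x - x₀))
    (hL : ∀ x ∈ Metric.closedBall x₀ 1, ‖fderiv ℝ (curl v) x‖ ≤ L) (hr : 0 < r) (hr1 : r ≤ 1) (hρ : 0 ≤ ρ) (hε : 0 ≤ ε)
    {U U' : Set E3} (hU : U ⊆ Metric.sphere x₀ r) (hU' : U' ⊆ Metric.sphere x₀ r) (hne' : U'.Nonempty)
    (hnear : ∀ q ∈ U', q ∈ U ∨ ∃ p ∈ closure U, ‖curl v p‖ ≤ ε ∧ ‖q - p‖ ≤ ρ) :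
    sSup (T '' U') ≤ sSup (T '' U) + (Real.pi * ε / (2 * r) * ρ + Real.pi ^ 2 * L / (4 * r) * ρ ^ 2) := by
  have hL0 : 0 ≤ L := (norm_nonneg _).trans (hL x₀ (Metric.mem_closedBall_self zero_le_one))
  have hc := continuousOn_sphere_of_continuousOn_compl hT.continuousOn hr
  have hclS : closure U ⊆ Metric.sphere x₀ r := closure_minimal hU Metric.isClosed_sphere
  have hbdd : BddAbove (T '' U) := (bddAbove_image_sphere hc).mono (image_mono hU)
  have hB0 : 0 ≤ Real.pi * ε / (2 * r) * ρ + Real.pi ^ 2 * L / (4 * r) * ρ ^ 2 := by positivity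
  refine csSup_le (hne'.image T) ?_
  rintro _ ⟨q, hq, rfl⟩
  rcases hnear q hq with hqU | ⟨p, hpU, hpε, hqp⟩
  · exact (le_csSup hbdd (mem_image_of_mem T hqU)).trans (le_add_of_nonneg_right hB0)
  · have h1 := abs_sub_le_of_norm_curl_le hv hT hrep hL hr hr1 (hclS hpU) hpε (hU' hq)
    have h2 : ‖q - p‖ ^ 2 ≤ ρ ^ 2 := pow_le_pow_left₀ (norm_nonneg _) hqp 2
    have h3 : T q - T p ≤ Real.pi * ε / (2 * r) * ρ + Real.pi ^ 2 * L / (4 * r) * ρ ^ 2 :=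
      ((le_abs_self _).trans h1).trans (add_le_add (mul_le_mul_of_nonneg_left hqp (by positivity))
        (mul_le_mul_of_nonneg_left h2 (by positivity)))
    have h4 := apply_le_csSup_of_mem_closure hc hU hpU
    linarith

/-- **Event step (lower half), `ε`-critical anchors**: under the same hypothesis,
`sInf (T '' U) − (π ε ρ /(2 r) + π² L ρ² /(4 r)) ≤ sInf (T '' U')`. [folklore] -/
theorem sInf_sub_le_sInf_of_near_approxCrit {v : E3 → E3} {T : E3 → ℝ} {x₀ : E3} {L r ρ ε : ℝ} (hv : ContDiff ℝ 2 v)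
    (hT : ContDiffOn ℝ 1 T ({x₀}ᶜ)) (hrep : ∀ x, curl v x = cross (gradient T x) (x - x₀))
    (hL : ∀ x ∈ Metric.closedBall x₀ 1, ‖fderiv ℝ (curl v) x‖ ≤ L) (hr : 0 < r) (hr1 : r ≤ 1) (hρ : 0 ≤ ρ) (hε : 0 ≤ ε)
    {U U' : Set E3} (hU : U ⊆ Metric.sphere x₀ r) (hU' : U' ⊆ Metric.sphere x₀ r) (hne' : U'.Nonempty)
    (hnear : ∀ q ∈ U', q ∈ U ∨ ∃ p ∈ closure U, ‖curl v p‖ ≤ ε ∧ ‖q - p‖ ≤ ρ) :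
    sInf (T '' U) - (Real.pi * ε / (2 * r) * ρ + Real.pi ^ 2 * L / (4 * r) * ρ ^ 2) ≤ sInf (T '' U') := by
  have hL0 : 0 ≤ L := (norm_nonneg _).trans (hL x₀ (Metric.mem_closedBall_self zero_le_one))
  have hc := continuousOn_sphere_of_continuousOn_compl hT.continuousOn hr
  have hclS : closure U ⊆ Metric.sphere x₀ r := closure_minimal hU Metric.isClosed_sphere
  have hbdd : BddBelow (T '' U) := ((isCompact_sphere x₀ r).bddBelow_image hc).mono (image_mono hU)
  have hB0 : 0 ≤ Real.pi * ε / (2 * r) * ρ + Real.pi ^ 2 * L / (4 * r) * ρ ^ 2 := by positivity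
  refine le_csInf (hne'.image T) ?_
  rintro _ ⟨q, hq, rfl⟩
  rcases hnear q hq with hqU | ⟨p, hpU, hpε, hqp⟩
  · linarith [csInf_le hbdd (mem_image_of_mem T hqU)]
  · have h1 := abs_sub_le_of_norm_curl_le hv hT hrep hL hr hr1 (hclS hpU) hpε (hU' hq)
    have h2 : ‖q - p‖ ^ 2 ≤ ρ ^ 2 := pow_le_pow_left₀ (norm_nonneg _) hqp 2
    have h12 : |T q - T p| ≤ Real.pi * ε / (2 * r) * ρ + Real.pi ^ 2 * L / (4 * r) * ρ ^ 2 :=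
      h1.trans (add_le_add (mul_le_mul_of_nonneg_left hqp (by positivity)) (mul_le_mul_of_nonneg_left h2 (by positivity)))
    have h3 := (abs_le.1 h12).1
    have h4 := csInf_le_apply_of_mem_closure hc hU hpU
    linarith

/-- ★ **Event step with approximately critical anchors**: two nonempty `U, U' ⊆ S_r(x₀)` (`0 < r ≤ 1`) that differ only within `ρ` of
`ε`-critical points of each other's closure satisfy `|osc_{U'} T − osc_U T| ≤ π ε ρ / r + π² L ρ² /(2 r)`.  With `ε = L|Δr|` (swept radial sliver,
`norm_curl_le_of_sphCrit_radius`) or `ε = M r |Δt|` (temporal sliver) and `ρ` the sliver width this is the «sliver lemma» of the Σ-0bR₂ roadmap.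
[folklore] -/
theorem abs_setOsc_sub_setOsc_le_of_near_approxCrit {v : E3 → E3} {T : E3 → ℝ} {x₀ : E3} {L r ρ ε : ℝ} (hv : ContDiff ℝ 2 v)
    (hT : ContDiffOn ℝ 1 T ({x₀}ᶜ)) (hrep : ∀ x, curl v x = cross (gradient T x) (x - x₀))
    (hL : ∀ x ∈ Metric.closedBall x₀ 1, ‖fderiv ℝ (curl v) x‖ ≤ L) (hr : 0 < r) (hr1 : r ≤ 1) (hρ : 0 ≤ ρ) (hε : 0 ≤ ε)
    {U U' : Set E3} (hU : U ⊆ Metric.sphere x₀ r) (hU' : U' ⊆ Metric.sphere x₀ r) (hne : U.Nonempty) (hne' : U'.Nonempty)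
    (hnear : ∀ q ∈ U', q ∈ U ∨ ∃ p ∈ closure U, ‖curl v p‖ ≤ ε ∧ ‖q - p‖ ≤ ρ)
    (hnear' : ∀ q ∈ U, q ∈ U' ∨ ∃ p ∈ closure U', ‖curl v p‖ ≤ ε ∧ ‖q - p‖ ≤ ρ) :
    |setOsc T U' - setOsc T U| ≤ Real.pi * ε * ρ / r + Real.pi ^ 2 * L * ρ ^ 2 / (2 * r) := by
  have h1 := sSup_le_sSup_add_of_near_approxCrit hv hT hrep hL hr hr1 hρ hε hU hU' hne' hnear
  have h2 := sInf_sub_le_sInf_of_near_approxCrit hv hT hrep hL hr hr1 hρ hε hU hU' hne' hnear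
  have h3 := sSup_le_sSup_add_of_near_approxCrit hv hT hrep hL hr hr1 hρ hε hU' hU hne hnear'
  have h4 := sInf_sub_le_sInf_of_near_approxCrit hv hT hrep hL hr hr1 hρ hε hU' hU hne hnear'
  have e : Real.pi * ε * ρ / r + Real.pi ^ 2 * L * ρ ^ 2 / (2 * r)
      = 2 * (Real.pi * ε / (2 * r) * ρ + Real.pi ^ 2 * L / (4 * r) * ρ ^ 2) := by
    field_simp
    ring
  rw [e, abs_le, setOsc, setOsc]
  constructor <;> linarith

end Summit.NavierStokesRegularity.NavierStokesRegularity.Theorems.PoloidalLiouville.CellFlux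

end
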